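import Literature.Topology.FourManifolds.LatticeFormsOrthogonalGroupHyperbolicSum
import HarnessLib

/-!
# `SO⁺(U^{⊕n}) = E_{U_i}(U_i^⊥)` for ALL `n ≥ 3` and EVERY plane `U_i`: Gritsenko–Hulek–Sankaran's (15)
# "`S̃O⁺(L) = E(L) = E_U(L₁) = ⟨t(c,a) ∣ a ∈ L₁, c = e or f⟩`" for the family `L = U^{⊕n}`
# (Gritsenko–Hulek–Sankaran, *J. Algebra* 322 (2009), Prop. 3.3 (iii), Prop. 3.4 (15), §3.2 Lemma 3.2, §4)

Trunk T-4MAN vocabulary. Rows g49-#7/#14 proved `SO⁺(3U) = E(3U)` and `SO⁺(4U) = E(4U)` in the nested models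
`(H ⊕ H) ⊕ H`, `((H ⊕ H) ⊕ H) ⊕ H` at the OUTER hyperbolic pair; row g49-#15 ran the pair-free statements over all
`U^{⊕n} = hyperbolicSum n`. This file is the PAIR version for the whole family: for every `n ≥ 3` and every plane index
`i : Fin n`, an isometry of `hyperbolicSum n` lies in `SO⁺` (preserves the orientation of the positive `n`-space and has
determinant `1`) iff it is an admissible word in the Eichler transvections `t(f_i, a)`, `t(e_i, a)`, `a ⊥ e_i, f_i` —
GHS's group `E_{U_i}(U_i^⊥)`. The induction "`SO⁺(L) = ⟨E_U(L₁), SO⁺(L₁)⟩`" of row g49-#7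
(`exists_uGens_eq_of_isOrientationPreserving_of_det_eq_one_prod`, core `Q = hyperbolicSum n` at its inner pair
`(e₀, f₀)`) produces words at the outer pair of `hyperbolicSum n ⊕ H`; they are carried to the plane `U_i` of
`hyperbolicSum (n+1)` along a model isometry ALIGNED so that the outer pair goes to `(e_i, f_i)` (§2: any hyperbolic pair
of `U^{⊕m}`, `m ≥ 2`, is moved to `(e_i, f_i)` by an isometry — GHS Prop. 3.3 (iii), proof), words travelling along
isometries by (t4) "`g t(e,a) g⁻¹ = t(g(e), g(a))`" (§1). Written for lane `lit-hodgefound` (Track 2 foundations; prover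
seat `lit-hodgefound-p18`, gen 50, row g50-#1). THEOREMS ONLY — no definition, no named fact, no instance, no notation.

## Source, verbatim (held text `paper:arxiv-0810.1614`)

* §3.3 p. 7: "`E_U(L₁) := ⟨{t(e,a), t(f,a) ∣ a ∈ L₁}⟩`. **Proposition 3.3.** Let `L = U ⊕ U₁ ⊕ L₀` […] (iii)
  `O(L) = ⟨E_U(L₁), O(L₁)⟩`. […] Notice that (iii) is true for all the groups we have considered: for instance,
  `Õ⁺(L) = ⟨E_U(L₁), Õ⁺(L₁)⟩` and similarly for `SO`, `S̃O`, etc.."; proof of (iii): "there exists `τ ∈ E_U(L₁)` such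
  that `τ(g(e)) = e` […] `h = t(e,−b)τg` acts trivially on `U`."
* §3.3 p. 7–8: "**Proposition 3.4.** Let `L = U ⊕ U₁ ⊕ L₀` be an even lattice with two hyperbolic planes, such that
  `rank₃(L) ≥ 5` and `rank₂(L) ≥ 6`. Then (15) `S̃O⁺(L) = O′(L) = E(L) = E_U(L₁)` […]
  `= ⟨{t(c,a) ∣ a ∈ L₁, c = e or f}⟩`."; §3.2 p. 6: "**Lemma 3.2.** `SO⁺(U ⊕ U₁)` is generated by the four
  transvections `t(e,e₁)`, `t(e,f₁)`, `t(f,e₁)` and `t(f,f₁)`."; §4 p. 8: "`Õ⁺(L) = ⟨S̃O⁺(L), σ_{e−f}⟩`";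
  §3.1 p. 5 (t4): "`g t(e,a) g⁻¹ = t(g(e), g(a))` for `g ∈ O(L)`".

For `L = U^{⊕n}` (unimodular, so `S̃O⁺ = SO⁺`, `Õ⁺ = O⁺`; `rank_p(L) = 2n ≥ 6`) (15) reads `SO⁺(U^{⊕n}) = E_U(U^⊥)`;
it is proved here for `n ≥ 3` by GHS's own induction from Lemma 3.2 (no Kneser theorem, no strong approximation).

## Contents (all proved)

* §1 transport along an isometry `e : (W,B) ⥲ (W′,B′)`: admissible words at `(x,y)` go to admissible words at
  `(e x, e y)` (`UGen.exists_uGens_isometryEquiv_eval`, (t4)); hence "`SO⁺ ⊆ E_U`" transports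
  (`exists_uGens_eq_of_isometryEquiv_of_forall`).
* §2 alignment: every hyperbolic pair of `U^{⊕m}`, `m ≥ 2`, is carried to `(e_i, f_i)` by an isometry
  (`hyperbolicSum_exists_isometryEquiv_apply_eq_single`); aligned model isometries `hyperbolicSum n ⊕ H ⥲ hyperbolicSum (n+1)`
  and `(H ⊕ H) ⊕ H ⥲ hyperbolicSum 3` sending the outer pair to `(e_i, f_i)`.
* §3 for all `n ≥ 3` and all `i`: **`hyperbolicSum_exists_uGens_eq_of_isOrientationPreserving_of_det_eq_one`**
  (`SO⁺(U^{⊕n}) ⊆ E_{U_i}`), **`hyperbolicSum_isOrientationPreserving_and_det_eq_one_iff_exists_uGens`**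
  (`SO⁺(U^{⊕n}) = E_{U_i}`), independence of the plane (`hyperbolicSum_exists_uGens_eq_uGens`, a face of
  Prop. 3.3 (ii) "`E(L) = E_U(L₁)`"), and **`O⁺(U^{⊕n}) = ⟨E_{U_i}, σ_{e_j−f_j}⟩`**
  (`hyperbolicSum_exists_uGens_eq_or_of_isOrientationPreserving`).
* §4 model-free: for every lattice `L ≅ U^{⊕n}`, `n ≥ 3`, and EVERY hyperbolic pair `(u, z)` of `L`,
  `SO⁺(L) = E_{⟨u,z⟩}` (`exists_uGens_eq_of_isOrientationPreserving_of_det_eq_one_of_isometryEquiv_hyperbolicSum`,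
  `isOrientationPreserving_and_det_eq_one_iff_exists_uGens_of_isometryEquiv_hyperbolicSum`), and the genus `II_{n,n}`
  hypothesis-style (even unimodular, rank `2n`, signature `0`).
-/

noncomputable section

open Module
open LinearMap (BilinForm)
open LinearMap.BilinForm
open LinearMap.BilinForm (IsometryEquiv)

namespace Literature.Topology.FourManifolds

universe u

/-! ### §1 Transport of admissible words along an isometry -/

section Transport

variable {W W' : Type*} [AddCommGroup W] [AddCommGroup W'] {B : BilinForm ℤ W} {B' : BilinForm ℤ W'} {x y : W}

/-- **(t4) `g t(e,a) g⁻¹ = t(g(e), g(a))` for words**: along an isometry `e : (W,B) ⥲ (W′,B′)`, an admissible word `l` in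
the transvections at `(x, y)` becomes an admissible word `l′` at `(e x, e y)` with `l′ ∘ e = e ∘ l` (letter by letter,
`t(y,a) ↦ t(e y, e a)`, `t(x,a) ↦ t(e x, e a)`). [cite: GritsenkoHulekSankaran2009, §3.1 (t4)] -/
theorem UGen.exists_uGens_isometryEquiv_eval (e : B.IsometryEquiv B') (l : List (UGen W))
    (hl : ∀ g ∈ l, g.IsAdmissible B x y) :
    ∃ l' : List (UGen W'), (∀ g ∈ l', g.IsAdmissible B' (e x) (e y)) ∧
      ∀ v, UGen.eval B' (e x) (e y) l' (e v) = e (UGen.eval B x y l v) := by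
  induction l with
  | nil => exact ⟨[], fun g hg ↦ (List.not_mem_nil hg).elim, fun v ↦ rfl⟩
  | cons g l ih =>
    obtain ⟨l', hl', hll'⟩ := ih fun g' hg' ↦ hl g' (List.mem_cons_of_mem g hg')
    have hg := hl g List.mem_cons_self
    cases g with
    | atY a q =>
      obtain ⟨hxa, hya, haq⟩ := hg
      refine ⟨UGen.atY (e a) q :: l', fun k hk ↦ ?_, fun v ↦ ?_⟩
      · rcases List.mem_cons.1 hk with rfl | hk
        · exact ⟨by rw [e.map_app]; exact hxa, by rw [e.map_app]; exact hya, by rw [e.map_app]; exact haq⟩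
        · exact hl' k hk
      · rw [UGen.eval_cons, UGen.eval_cons, LinearMap.comp_apply, LinearMap.comp_apply, hll']
        exact (LinearMap.BilinForm.IsometryEquiv.map_eichlerTransvection_apply e y a q _).symm
    | atX a q =>
      obtain ⟨hxa, hya, haq⟩ := hg
      refine ⟨UGen.atX (e a) q :: l', fun k hk ↦ ?_, fun v ↦ ?_⟩
      · rcases List.mem_cons.1 hk with rfl | hk
        · exact ⟨by rw [e.map_app]; exact hxa, by rw [e.map_app]; exact hya, by rw [e.map_app]; exact haq⟩
        · exact hl' k hk
      · rw [UGen.eval_cons, UGen.eval_cons, LinearMap.comp_apply, LinearMap.comp_apply, hll']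
        exact (LinearMap.BilinForm.IsometryEquiv.map_eichlerTransvection_apply e x a q _).symm

end Transport

section TransportSO

variable {W W' : Type u} [AddCommGroup W] [Module.Finite ℤ W] [Module.Free ℤ W] [AddCommGroup W'] [Module.Finite ℤ W']
  [Module.Free ℤ W'] {B : BilinForm ℤ W} {B' : BilinForm ℤ W'} {x y : W}

/-- **"`SO⁺ ⊆ E_U`" travels along isometries**: if every isometry of `(W,B)` in `O⁺` with determinant `1` is an
admissible word at `(x, y)`, then every isometry of `(W′,B′) ≅ (W,B)` in `O⁺` with determinant `1` is an admissible word at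
`(e x, e y)` (`O⁺` and `det` are conjugation invariant; words transport by (t4)).
[cite: GritsenkoHulekSankaran2009, §3.1 (t4) and §3.3 (remark after Prop. 3.3, "similarly for SO")] -/
theorem exists_uGens_eq_of_isometryEquiv_of_forall (e : B.IsometryEquiv B')
    (H : ∀ φ : B.IsometryEquiv B, φ.IsOrientationPreserving → LinearMap.det (φ : W →ₗ[ℤ] W) = 1 →
      ∃ l : List (UGen W), (∀ g ∈ l, g.IsAdmissible B x y) ∧ ∀ v, φ v = UGen.eval B x y l v)
    (φ' : B'.IsometryEquiv B') (h₁ : φ'.IsOrientationPreserving) (h₂ : LinearMap.det (φ' : W' →ₗ[ℤ] W') = 1) :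
    ∃ l' : List (UGen W'), (∀ g ∈ l', g.IsAdmissible B' (e x) (e y)) ∧ ∀ v, φ' v = UGen.eval B' (e x) (e y) l' v := by
  have hφ₁ : (e.trans (φ'.trans e.symm)).IsOrientationPreserving :=
    (LinearMap.BilinForm.IsometryEquiv.isOrientationPreserving_trans_trans_symm_iff e φ').2 h₁
  have hφ₂ : LinearMap.det ((e.trans (φ'.trans e.symm) : B.IsometryEquiv B) : W →ₗ[ℤ] W) = 1 := by
    rw [IsometryEquiv.det_trans_trans_symm, h₂]
  obtain ⟨l, hl, hlv⟩ := H _ hφ₁ hφ₂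
  obtain ⟨l', hl', hl'v⟩ := UGen.exists_uGens_isometryEquiv_eval e l hl
  refine ⟨l', hl', fun v ↦ ?_⟩
  obtain ⟨w, rfl⟩ : ∃ w, e w = v := ⟨e.symm v, LinearMap.BilinForm.IsometryEquiv.apply_symm_apply e v⟩
  rw [hl'v, ← hlv, LinearMap.BilinForm.IsometryEquiv.trans_apply, LinearMap.BilinForm.IsometryEquiv.trans_apply,
    LinearMap.BilinForm.IsometryEquiv.apply_symm_apply]

end TransportSO

/-! ### §2 Alignment of hyperbolic pairs in `U^{⊕m}` and aligned model isometries -/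

section Alignment

/-- **Every hyperbolic pair `(u, z)` of `U^{⊕m}` is carried to `(e_i, f_i)` by an isometry** (`m ≥ 2`: a second plane
`U_j`, `j ≠ i`, is needed) — GHS Prop. 3.3 (iii), proof, for the base pair `(f_i, e_i)`.
[cite: GritsenkoHulekSankaran2009, Prop. 3.3 (iii), proof] -/
theorem hyperbolicSum_exists_isometryEquiv_apply_eq_single {m : ℕ} {i j : Fin m} (hij : i ≠ j)
    {u z : (Fin m → ℤ) × (Fin m → ℤ)} (hu : hyperbolicSum m u u = 0) (huz : hyperbolicSum m u z = 1)
    (hz : hyperbolicSum m z z = 0) :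
    ∃ g : (hyperbolicSum m).IsometryEquiv (hyperbolicSum m), g u = (Pi.single i 1, 0) ∧ g z = (0, Pi.single i 1) :=
  (twoHyperbolicPairs_hyperbolicSum hij).symm_left.exists_isometryEquiv_apply_eq_and_apply_eq (isEven_hyperbolicSum m)
    hu huz hz

/-- **Aligned model isometry `U^{⊕n} ⊕ H ⥲ U^{⊕(n+1)}`** (`n ≥ 1`): an isometry sending the outer pair `(x, y)` of `H` to
the plane `(e_i, f_i)`. [cite: GritsenkoHulekSankaran2009, Prop. 3.3 (iii), proof] [cite: Huybrechts2016K3, Ch. 14 Cor. 1.3 (i)] -/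
theorem exists_isometryEquiv_prod_hyperbolicForm_hyperbolicSum_succ_apply_eq {n : ℕ} (hn : 1 ≤ n) (i : Fin (n + 1)) :
    ∃ e : ((hyperbolicSum n).prod hyperbolicForm).IsometryEquiv (hyperbolicSum (n + 1)),
      e hypX = (Pi.single i 1, 0) ∧ e hypY = (0, Pi.single i 1) := by
  obtain ⟨e₀⟩ := hyperbolicSum_succ_equivalent_prod_hyperbolicForm n
  obtain ⟨j, hj⟩ : ∃ j : Fin (n + 1), i ≠ j := by
    by_cases hi : i = ⟨0, by omega⟩
    · exact ⟨⟨1, by omega⟩, by rw [hi]; simp [Fin.ext_iff]⟩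
    · exact ⟨⟨0, by omega⟩, hi⟩
  have hu : hyperbolicSum (n + 1) (e₀.symm hypX) (e₀.symm hypX) = 0 := by
    rw [e₀.symm.map_app, prod_hyperbolic_hypX_hypX]
  have huz : hyperbolicSum (n + 1) (e₀.symm hypX) (e₀.symm hypY) = 1 := by
    rw [e₀.symm.map_app, prod_hyperbolic_hypX_hypY]
  have hz : hyperbolicSum (n + 1) (e₀.symm hypY) (e₀.symm hypY) = 0 := by
    rw [e₀.symm.map_app, prod_hyperbolic_hypY_hypY]
  obtain ⟨g, hgu, hgz⟩ := hyperbolicSum_exists_isometryEquiv_apply_eq_single hj hu huz hz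
  exact ⟨e₀.symm.trans g, by rw [LinearMap.BilinForm.IsometryEquiv.trans_apply, hgu],
    by rw [LinearMap.BilinForm.IsometryEquiv.trans_apply, hgz]⟩

/-- **Aligned model isometry `(H ⊕ H) ⊕ H ⥲ U^{⊕3}`**: an isometry sending the outer pair `(x, y)` to the plane
`(e_i, f_i)`. [cite: GritsenkoHulekSankaran2009, Prop. 3.3 (iii), proof] [cite: Huybrechts2016K3, Ch. 14 Cor. 1.3 (i)] -/
theorem exists_isometryEquiv_threeU_hyperbolicSum_apply_eq (i : Fin 3) :
    ∃ e : ((hyperbolicForm.prod hyperbolicForm).prod hyperbolicForm).IsometryEquiv (hyperbolicSum 3),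
      e hypX = (Pi.single i 1, 0) ∧ e hypY = (0, Pi.single i 1) := by
  obtain ⟨e₀⟩ := nonempty_isometryEquiv_threeU_hyperbolicSum
  obtain ⟨j, hj⟩ : ∃ j : Fin 3, i ≠ j := by
    by_cases hi : i = 0
    · exact ⟨1, by rw [hi]; decide⟩
    · exact ⟨0, hi⟩
  have hu : hyperbolicSum 3 (e₀ hypX) (e₀ hypX) = 0 := by rw [e₀.map_app, prod_hyperbolic_hypX_hypX]
  have huz : hyperbolicSum 3 (e₀ hypX) (e₀ hypY) = 1 := by rw [e₀.map_app, prod_hyperbolic_hypX_hypY]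
  have hz : hyperbolicSum 3 (e₀ hypY) (e₀ hypY) = 0 := by rw [e₀.map_app, prod_hyperbolic_hypY_hypY]
  obtain ⟨g, hgu, hgz⟩ := hyperbolicSum_exists_isometryEquiv_apply_eq_single hj hu huz hz
  exact ⟨e₀.trans g, by rw [LinearMap.BilinForm.IsometryEquiv.trans_apply, hgu],
    by rw [LinearMap.BilinForm.IsometryEquiv.trans_apply, hgz]⟩

end Alignment

/-! ### §3 `SO⁺(U^{⊕n}) = E_{U_i}` for all `n ≥ 3` and every plane `U_i` -/

section HyperbolicSum

/-- **GHS (15) for `U^{⊕n}`, `n ≥ 3`, at every plane: `SO⁺(U^{⊕n}) ⊆ E_{U_i}(U_i^⊥)`** — every isometry of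
`hyperbolicSum n` preserving the orientation of the positive `n`-space and of determinant `1` is an admissible word in
the Eichler transvections `t(f_i, a)`, `t(e_i, a)`, `a ⊥ e_i, f_i` (induction on `n`: Lemma 3.2 gives `3U` (row g49-#7),
and "`SO⁺(L) = ⟨E_U(L₁), SO⁺(L₁)⟩`" the step `U^{⊕n} ⊕ U`, transported to the plane `U_i` along an aligned isometry).
[cite: GritsenkoHulekSankaran2009, Prop. 3.4 (15), §3.2 Lemma 3.2 and §3.3 (remark after Prop. 3.3)] -/
theorem hyperbolicSum_exists_uGens_eq_of_isOrientationPreserving_of_det_eq_one {n : ℕ} (hn : 3 ≤ n) :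
    ∀ (i : Fin n) (φ : (hyperbolicSum n).IsometryEquiv (hyperbolicSum n)), φ.IsOrientationPreserving →
      LinearMap.det (φ : (Fin n → ℤ) × (Fin n → ℤ) →ₗ[ℤ] (Fin n → ℤ) × (Fin n → ℤ)) = 1 →
      ∃ l : List (UGen ((Fin n → ℤ) × (Fin n → ℤ))),
        (∀ g ∈ l, g.IsAdmissible (hyperbolicSum n) (Pi.single i 1, 0) (0, Pi.single i 1)) ∧
        ∀ v, φ v = UGen.eval (hyperbolicSum n) (Pi.single i 1, 0) (0, Pi.single i 1) l v := by
  induction n, hn using Nat.le_induction with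
  | base =>
    intro i φ h₁ h₂
    obtain ⟨e, hx, hy⟩ := exists_isometryEquiv_threeU_hyperbolicSum_apply_eq i
    obtain ⟨l, hl, hlv⟩ := exists_uGens_eq_of_isometryEquiv_of_forall e
      (fun ψ hψ₁ hψ₂ ↦ exists_uGens_eq_of_isOrientationPreserving_of_det_eq_one_threeU ψ hψ₁ hψ₂) φ h₁ h₂
    rw [hx, hy] at hl hlv
    exact ⟨l, hl, hlv⟩
  | succ n hn ih =>
    intro i φ h₁ h₂
    obtain ⟨e, hx, hy⟩ := exists_isometryEquiv_prod_hyperbolicForm_hyperbolicSum_succ_apply_eq (n := n) (by omega) i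
    have h01 : hyperbolicSum n (Pi.single (⟨0, by omega⟩ : Fin n) 1, 0) (0, Pi.single (⟨0, by omega⟩ : Fin n) 1) = 1 := by
      rw [hyperbolicSum_inl_inr, if_pos rfl]
    obtain ⟨l, hl, hlv⟩ := exists_uGens_eq_of_isometryEquiv_of_forall e
      (exists_uGens_eq_of_isOrientationPreserving_of_det_eq_one_prod (isSymm_hyperbolicSum n) (isEven_hyperbolicSum n)
        (isUnimodular_hyperbolicSum n).nondegenerate (x₁ := (Pi.single (⟨0, by omega⟩ : Fin n) 1, 0))
        (y₁ := (0, Pi.single (⟨0, by omega⟩ : Fin n) 1)) (hyperbolicSum_inl_inl n _ _) (hyperbolicSum_inr_inr n _ _) h01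
        (ih ⟨0, by omega⟩)) φ h₁ h₂
    rw [hx, hy] at hl hlv
    exact ⟨l, hl, hlv⟩

/-- **GHS (15) for `U^{⊕n}`, `n ≥ 3`: `SO⁺(U^{⊕n}) = E_{U_i}(U_i^⊥)`** — an isometry of `hyperbolicSum n` lies in `O⁺` with
determinant `1` iff it is an admissible word at the plane `(e_i, f_i)` (admissible words lie in `S̃O⁺`, §3.1 (8)).
[cite: GritsenkoHulekSankaran2009, Prop. 3.4 (15) and §3.1 (8)] -/
theorem hyperbolicSum_isOrientationPreserving_and_det_eq_one_iff_exists_uGens {n : ℕ} (hn : 3 ≤ n) (i : Fin n)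
    (φ : (hyperbolicSum n).IsometryEquiv (hyperbolicSum n)) :
    (φ.IsOrientationPreserving ∧ LinearMap.det (φ : (Fin n → ℤ) × (Fin n → ℤ) →ₗ[ℤ] (Fin n → ℤ) × (Fin n → ℤ)) = 1) ↔
      ∃ (L : List (UGen ((Fin n → ℤ) × (Fin n → ℤ))))
        (hL : ∀ g ∈ L, g.IsAdmissible (hyperbolicSum n) (Pi.single i 1, 0) (0, Pi.single i 1)),
        φ = UGen.evalEquiv (isSymm_hyperbolicSum n) (hyperbolicSum_inl_inl n (Pi.single i 1) (Pi.single i 1))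
          (hyperbolicSum_inr_inr n (Pi.single i 1) (Pi.single i 1)) L hL := by
  constructor
  · rintro ⟨h₁, h₂⟩
    obtain ⟨L, hL, hφ⟩ := hyperbolicSum_exists_uGens_eq_of_isOrientationPreserving_of_det_eq_one hn i φ h₁ h₂
    exact ⟨L, hL, DFunLike.ext _ _ fun v ↦ by rw [hφ, UGen.evalEquiv_apply]⟩
  · rintro ⟨L, hL, rfl⟩
    exact (UGen.evalEquiv_mem_stableSpecialOrthogonal (isSymm_hyperbolicSum n) (isUnimodular_hyperbolicSum n).nondegenerate
      _ _ L hL).2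

/-- **The plane does not matter: `E_{U_i}(U_i^⊥) = E_{U_j}(U_j^⊥)` in `U^{⊕n}`, `n ≥ 3`** — an admissible word at
`(e_i, f_i)` is (pointwise) an admissible word at `(e_j, f_j)` (both groups are `SO⁺(U^{⊕n})`; a face of Prop. 3.3 (ii)
"`E(L) = E_U(L₁)`"). [cite: GritsenkoHulekSankaran2009, Prop. 3.3 (ii) and Prop. 3.4 (15)] -/
theorem hyperbolicSum_exists_uGens_eq_uGens {n : ℕ} (hn : 3 ≤ n) (i j : Fin n) (L : List (UGen ((Fin n → ℤ) × (Fin n → ℤ))))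
    (hL : ∀ g ∈ L, g.IsAdmissible (hyperbolicSum n) (Pi.single i 1, 0) (0, Pi.single i 1)) :
    ∃ l : List (UGen ((Fin n → ℤ) × (Fin n → ℤ))),
      (∀ g ∈ l, g.IsAdmissible (hyperbolicSum n) (Pi.single j 1, 0) (0, Pi.single j 1)) ∧
      ∀ v, UGen.eval (hyperbolicSum n) (Pi.single i 1, 0) (0, Pi.single i 1) L v =
        UGen.eval (hyperbolicSum n) (Pi.single j 1, 0) (0, Pi.single j 1) l v := by
  have hS := UGen.evalEquiv_mem_stableSpecialOrthogonal (isSymm_hyperbolicSum n) (isUnimodular_hyperbolicSum n).nondegenerate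
    (hyperbolicSum_inl_inl n (Pi.single i 1) (Pi.single i 1)) (hyperbolicSum_inr_inr n (Pi.single i 1) (Pi.single i 1)) L hL
  obtain ⟨l, hl, hlv⟩ := hyperbolicSum_exists_uGens_eq_of_isOrientationPreserving_of_det_eq_one hn j _ hS.2.1 hS.2.2
  exact ⟨l, hl, fun v ↦ by rw [← hlv, UGen.evalEquiv_apply]⟩

/-- `e_j − f_j` is a `(−2)`-vector of `U^{⊕n}`. [cite: GritsenkoHulekSankaran2009, §4 ("σ_{e−f}")] -/
theorem hyperbolicSum_single_neg_single (n : ℕ) (j : Fin n) :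
    hyperbolicSum n ((Pi.single j 1, -Pi.single j 1) : (Fin n → ℤ) × (Fin n → ℤ)) (Pi.single j 1, -Pi.single j 1) = -1 + -1 := by
  rw [hyperbolicSum_apply]
  simp

/-- **`O⁺(U^{⊕n}) = ⟨E_{U_i}, σ_{e_j−f_j}⟩` for `n ≥ 3`** ("`Õ⁺(L) = ⟨S̃O⁺(L), σ_{e−f}⟩`"): every isometry of `hyperbolicSum n`
in `O⁺` is an admissible word at `(e_i, f_i)`, or becomes one after the `(−2)`-reflection `σ_{e_j−f_j}` (which lies in `O⁺`
with determinant `−1`). [cite: GritsenkoHulekSankaran2009, §4 ("Õ⁺(L) = ⟨S̃O⁺(L), σ_{e−f}⟩") and Prop. 3.4 (15)–(16)] -/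
theorem hyperbolicSum_exists_uGens_eq_or_of_isOrientationPreserving {n : ℕ} (hn : 3 ≤ n) (i j : Fin n)
    (φ : (hyperbolicSum n).IsometryEquiv (hyperbolicSum n)) (h₁ : φ.IsOrientationPreserving) :
    (∃ l : List (UGen ((Fin n → ℤ) × (Fin n → ℤ))),
        (∀ g ∈ l, g.IsAdmissible (hyperbolicSum n) (Pi.single i 1, 0) (0, Pi.single i 1)) ∧
        ∀ v, φ v = UGen.eval (hyperbolicSum n) (Pi.single i 1, 0) (0, Pi.single i 1) l v) ∨
    ∃ l : List (UGen ((Fin n → ℤ) × (Fin n → ℤ))),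
        (∀ g ∈ l, g.IsAdmissible (hyperbolicSum n) (Pi.single i 1, 0) (0, Pi.single i 1)) ∧
        ∀ v, (φ.trans (normTwoReflectionEquiv (isSymm_hyperbolicSum n) (Pi.single j 1, -Pi.single j 1) (-1)
            (hyperbolicSum_single_neg_single n j) (by norm_num))) v =
          UGen.eval (hyperbolicSum n) (Pi.single i 1, 0) (0, Pi.single i 1) l v := by
  have hB := isSymm_hyperbolicSum n
  have hnd := (isUnimodular_hyperbolicSum n).nondegenerate
  set σ := normTwoReflectionEquiv hB (Pi.single j 1, -Pi.single j 1) (-1) (hyperbolicSum_single_neg_single n j)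
    (by norm_num) with hσ
  rcases LinearMap.BilinForm.IsometryEquiv.det_eq_one_or_eq_neg_one φ with hdet | hdet
  · exact Or.inl (hyperbolicSum_exists_uGens_eq_of_isOrientationPreserving_of_det_eq_one hn i φ h₁ hdet)
  · refine Or.inr (hyperbolicSum_exists_uGens_eq_of_isOrientationPreserving_of_det_eq_one hn i _ ?_ ?_)
    · have hσO : σ.IsOrientationPreserving := by
        rw [hσ, isOrientationPreserving_normTwoReflectionEquiv_iff _ hB hnd]
      exact (LinearMap.BilinForm.IsometryEquiv.isOrientationPreserving_trans_iff hB hnd φ σ).2 (iff_of_true hσO h₁)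
    · rw [show ((φ.trans σ : (hyperbolicSum n).IsometryEquiv (hyperbolicSum n)) :
          (Fin n → ℤ) × (Fin n → ℤ) →ₗ[ℤ] (Fin n → ℤ) × (Fin n → ℤ)) =
          (σ : (Fin n → ℤ) × (Fin n → ℤ) →ₗ[ℤ] (Fin n → ℤ) × (Fin n → ℤ)) ∘ₗ
            (φ : (Fin n → ℤ) × (Fin n → ℤ) →ₗ[ℤ] (Fin n → ℤ) × (Fin n → ℤ)) from LinearMap.ext fun _ ↦ rfl,
        LinearMap.det_comp, hdet, hσ, det_normTwoReflectionEquiv]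
      norm_num

end HyperbolicSum

/-! ### §4 Every lattice isometric to `U^{⊕n}`, `n ≥ 3`, at every hyperbolic pair -/

section Model

variable {W' : Type} [AddCommGroup W'] [Module.Finite ℤ W'] [Module.Free ℤ W'] {B' : BilinForm ℤ W'}

/-- **`SO⁺(L) = E_U(L₁)` for every `L ≅ U^{⊕n}`, `n ≥ 3`, and every splitting `L = U ⊕ L₁`**: for a lattice `(W′,B′)`
isometric to `hyperbolicSum n` and ANY hyperbolic pair `(u, z)` of `W′` (`u² = z² = 0`, `u·z = 1`), every isometry in `O⁺`
with determinant `1` is an admissible word in the transvections `t(z,a)`, `t(u,a)`, `a ⊥ u, z` (align `(u,z)` with `(e₀,f₀)`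
inside `U^{⊕n}`, then transport §3). [cite: GritsenkoHulekSankaran2009, Prop. 3.4 (15) and Prop. 3.3 (iii)] -/
theorem exists_uGens_eq_of_isOrientationPreserving_of_det_eq_one_of_isometryEquiv_hyperbolicSum {n : ℕ} (hn : 3 ≤ n)
    (e : (hyperbolicSum n).IsometryEquiv B') {u z : W'} (hu : B' u u = 0) (huz : B' u z = 1) (hz : B' z z = 0)
    (φ' : B'.IsometryEquiv B') (h₁ : φ'.IsOrientationPreserving) (h₂ : LinearMap.det (φ' : W' →ₗ[ℤ] W') = 1) :
    ∃ l : List (UGen W'), (∀ g ∈ l, g.IsAdmissible B' u z) ∧ ∀ v, φ' v = UGen.eval B' u z l v := by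
  have hi : (⟨0, by omega⟩ : Fin n) ≠ ⟨1, by omega⟩ := by simp [Fin.ext_iff]
  have hu' : hyperbolicSum n (e.symm u) (e.symm u) = 0 := by rw [e.symm.map_app, hu]
  have huz' : hyperbolicSum n (e.symm u) (e.symm z) = 1 := by rw [e.symm.map_app, huz]
  have hz' : hyperbolicSum n (e.symm z) (e.symm z) = 0 := by rw [e.symm.map_app, hz]
  obtain ⟨g, hgu, hgz⟩ := hyperbolicSum_exists_isometryEquiv_apply_eq_single hi hu' huz' hz'
  have hx : (g.symm.trans e) (Pi.single (⟨0, by omega⟩ : Fin n) 1, 0) = u := by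
    rw [LinearMap.BilinForm.IsometryEquiv.trans_apply, ← hgu, LinearMap.BilinForm.IsometryEquiv.symm_apply_apply,
      LinearMap.BilinForm.IsometryEquiv.apply_symm_apply]
  have hy : (g.symm.trans e) (0, Pi.single (⟨0, by omega⟩ : Fin n) 1) = z := by
    rw [LinearMap.BilinForm.IsometryEquiv.trans_apply, ← hgz, LinearMap.BilinForm.IsometryEquiv.symm_apply_apply,
      LinearMap.BilinForm.IsometryEquiv.apply_symm_apply]
  obtain ⟨l, hl, hlv⟩ := exists_uGens_eq_of_isometryEquiv_of_forall (g.symm.trans e)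
    (hyperbolicSum_exists_uGens_eq_of_isOrientationPreserving_of_det_eq_one hn ⟨0, by omega⟩) φ' h₁ h₂
  rw [hx, hy] at hl hlv
  exact ⟨l, hl, hlv⟩

/-- **`SO⁺(L) = E_U(L₁)` as an iff, for every `L ≅ U^{⊕n}`, `n ≥ 3`, at every hyperbolic pair `(u, z)`**: in `O⁺` with
determinant `1` iff an admissible word at `(u, z)`. [cite: GritsenkoHulekSankaran2009, Prop. 3.4 (15) and §3.1 (8)] -/
theorem isOrientationPreserving_and_det_eq_one_iff_exists_uGens_of_isometryEquiv_hyperbolicSum {n : ℕ} (hn : 3 ≤ n)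
    (hB' : B'.IsSymm) (hnd' : B'.Nondegenerate) (e : (hyperbolicSum n).IsometryEquiv B') {u z : W'} (hu : B' u u = 0)
    (huz : B' u z = 1) (hz : B' z z = 0) (φ' : B'.IsometryEquiv B') :
    (φ'.IsOrientationPreserving ∧ LinearMap.det (φ' : W' →ₗ[ℤ] W') = 1) ↔
      ∃ (L : List (UGen W')) (hL : ∀ g ∈ L, g.IsAdmissible B' u z), φ' = UGen.evalEquiv hB' hu hz L hL := by
  constructor
  · rintro ⟨h₁, h₂⟩
    obtain ⟨L, hL, hφ⟩ :=
      exists_uGens_eq_of_isOrientationPreserving_of_det_eq_one_of_isometryEquiv_hyperbolicSum hn e hu huz hz φ' h₁ h₂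
    exact ⟨L, hL, DFunLike.ext _ _ fun v ↦ by rw [hφ, UGen.evalEquiv_apply]⟩
  · rintro ⟨L, hL, rfl⟩
    exact (UGen.evalEquiv_mem_stableSpecialOrthogonal hB' hnd' hu hz L hL).2

end Model

/-! ### §5 Every even unimodular lattice of signature `(n, n)`, `n ≥ 3` (the genus `II_{n,n}`), at every hyperbolic pair -/

section EvenUnimodular

variable {W : Type} [AddCommGroup W] [Module.Finite ℤ W] [Module.Free ℤ W] {B : BilinForm ℤ W}

/-- **GHS (15) for `II_{n,n}`, `n ≥ 3`**: for every even unimodular lattice of rank `2n ≥ 6` and signature `0` (`≅ U^{⊕n}`) and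
every hyperbolic pair `(u, z)` in it, `SO⁺ ⊆ E_{⟨u,z⟩}` — every isometry in `O⁺` with determinant `1` is an admissible word
in the transvections at `(u, z)`. [cite: GritsenkoHulekSankaran2009, Prop. 3.4 (15)] [cite: Huybrechts2016K3, Ch. 14 Cor. 1.3 (i)] -/
theorem exists_uGens_eq_of_isOrientationPreserving_of_det_eq_one_of_isUnimodular_of_isEven (hB : B.IsSymm)
    (hU : B.IsUnimodular) (he : B.IsEven) {n : ℕ} (hn : 3 ≤ n) (hrank : finrank ℤ W = 2 * n) (hsig : B.signature = 0)
    {u z : W} (hu : B u u = 0) (huz : B u z = 1) (hz : B z z = 0) (φ : B.IsometryEquiv B)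
    (h₁ : φ.IsOrientationPreserving) (h₂ : LinearMap.det (φ : W →ₗ[ℤ] W) = 1) :
    ∃ l : List (UGen W), (∀ g ∈ l, g.IsAdmissible B u z) ∧ ∀ v, φ v = UGen.eval B u z l v := by
  obtain ⟨e⟩ := equivalent_hyperbolicSum_of_signature_eq_zero _ hB hU he (by omega) hrank hsig
  exact exists_uGens_eq_of_isOrientationPreserving_of_det_eq_one_of_isometryEquiv_hyperbolicSum hn e.symm hu huz hz φ h₁ h₂

/-- **GHS (15) for `II_{n,n}`, `n ≥ 3`, as an iff**: for every even unimodular lattice of rank `2n ≥ 6` and signature `0` and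
every hyperbolic pair `(u, z)`: `SO⁺ = E_{⟨u,z⟩}`. [cite: GritsenkoHulekSankaran2009, Prop. 3.4 (15) and §3.1 (8)] [cite: Huybrechts2016K3, Ch. 14 Cor. 1.3 (i)] -/
theorem isOrientationPreserving_and_det_eq_one_iff_exists_uGens_of_isUnimodular_of_isEven (hB : B.IsSymm)
    (hU : B.IsUnimodular) (he : B.IsEven) {n : ℕ} (hn : 3 ≤ n) (hrank : finrank ℤ W = 2 * n) (hsig : B.signature = 0)
    {u z : W} (hu : B u u = 0) (huz : B u z = 1) (hz : B z z = 0) (φ : B.IsometryEquiv B) :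
    (φ.IsOrientationPreserving ∧ LinearMap.det (φ : W →ₗ[ℤ] W) = 1) ↔
      ∃ (L : List (UGen W)) (hL : ∀ g ∈ L, g.IsAdmissible B u z), φ = UGen.evalEquiv hB hu hz L hL := by
  obtain ⟨e⟩ := equivalent_hyperbolicSum_of_signature_eq_zero _ hB hU he (by omega) hrank hsig
  exact isOrientationPreserving_and_det_eq_one_iff_exists_uGens_of_isometryEquiv_hyperbolicSum hn hB hU.nondegenerate e.symm
    hu huz hz φ

end EvenUnimodular

end Literature.Topology.FourManifolds

end
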